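import Mathlib
import HarnessLib
import Summits.ResolutionOfSingularities.ResolutionOfSingularities.Theorems.WildQuotientsWildQuotientResolutionS1aTparabKillsIn

/-!
# S1a — R4b ★ `parabola_killsIn_two`: the PARABOLA TAIL `x₃ ↦ x₃ + (x₂ − x₁²)` is a two-shot kill — the first NON-ORIGIN centre, `Q = (x₁, u) = (½, −¼)`

[OURS · L1 W4.5c · lead-1 g16; plan-1 RULING R-F15n (3) «R4b `parabola_killsIn_two` (f = x₂ − x₁²): the same two moves translated to Q = (1/2, 1/4) (affine recoordination
y = x₁ − 1/2, v = x₂ − x₁ + 1/4, f = v − y² exactly). First non-origin centre» / memo X-CERT/R4 §1 (far tangency point of the parabola); lead-1 g16 observation: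
in the coordinates `(x₀, y, v, x₃)` the parabola datum IS the R4 normal form of the tangent parabola (`σy = y + x₀`, `σv = v`, `σx₃ = x₃ + (v − y²)`), so R4b is
✓`tparab_killsIn_two` after an AFFINE recoordination absorbed into `e` — the root `(x₀ : 3, y : 1, v : 2)` sits at `Q`, the member kills the whole strict transform of
`F = V(x₀, x₂ − x₁²)`] — NOT statements of the manuscript; counted 0; AI-level work, weaker than expert review. Crux stmt-ResolutionOfSingularities-17941
`CyclicQuotientFourfolds`, line `s1a-logminvertex` v13 (`stub_reachLowerInFX`).

* `FreeModel.exists_affineRecoord_parabola` — the `k`-algebra automorphism `γ : x₁ ↦ x₁ + c, x₂ ↦ x₂ + x₁ + c²` (others fixed; `2c = 1`) with its inverse;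
* ★★★ `GameFrame.GModel.parabola_killsIn_two` — σ: `x₁ ↦ x₁ + x₀`, `x₂ ↦ x₂ + x₀`, `x₃ ↦ x₃ + (x₂ − x₁²)`, `p ≠ 2` ⇒ `KillsIn 2 (GModel.initial hq h₀)`;
* ★★★ `GameFrame.GModel.exists_reachLowerF_initial_of_parabola` — the class of the research stub.
-/

set_option linter.dupNamespace false

noncomputable section

open CategoryTheory Limits AlgebraicGeometry TopologicalSpace Topology Opposite MvPolynomial
open Literature.AlgebraicGeometry.Resolution Literature.AlgebraicGeometry.RelativeSpec
open Summit.ResolutionOfSingularities.ResolutionOfSingularities.Theorems.WildQuotientResolution.S1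
open Summit.ResolutionOfSingularities.ResolutionOfSingularities.Theorems.WildQuotientResolution.S1.NodeAtlas
open Summit.ResolutionOfSingularities.ResolutionOfSingularities.Theorems.WildQuotientResolution.S1.GoodCharts
open Summit.ResolutionOfSingularities.ResolutionOfSingularities.Theorems.WildQuotientResolution.S1.NpFrame

namespace Summit.ResolutionOfSingularities.ResolutionOfSingularities.Theorems.WildQuotientResolution.S1.FreeModel

/-- **The affine recoordination of the parabola**: for `2c = 1` in `k`, the `k`-algebra automorphism `γ` of `k[x₀..x₃]` with `γx₁ = x₁ + c`, `γx₂ = x₂ + x₁ + c²`,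
`γx₀ = x₀`, `γx₃ = x₃` (old coordinates in terms of the new ones `y = x₁ − c`, `v = x₂ − x₁ + c²`), with its inverse. [folklore] -/
theorem exists_affineRecoord_parabola (k : Type) [Field k] (c : k) (hc : 2 * c = 1) :
    ∃ γ : MvPolynomial (Fin 4) k ≃ₐ[k] MvPolynomial (Fin 4) k, γ (X 0) = X 0 ∧ γ (X 1) = X 1 + C c ∧ γ (X 2) = X 2 + X 1 + C (c * c) ∧ γ (X 3) = X 3 ∧
      γ.symm (X 0) = X 0 ∧ γ.symm (X 1) = X 1 - C c ∧ γ.symm (X 2) = X 2 - X 1 + C (c * c) ∧ γ.symm (X 3) = X 3 := by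
  let F : Fin 4 → MvPolynomial (Fin 4) k := ![X 0, X 1 + C c, X 2 + X 1 + C (c * c), X 3]
  let G' : Fin 4 → MvPolynomial (Fin 4) k := ![X 0, X 1 - C c, X 2 - X 1 + C (c * c), X 3]
  let f : MvPolynomial (Fin 4) k →ₐ[k] MvPolynomial (Fin 4) k := aeval F
  let g : MvPolynomial (Fin 4) k →ₐ[k] MvPolynomial (Fin 4) k := aeval G'
  have hf0 : f (X 0) = X 0 := aeval_X F 0
  have hf1 : f (X 1) = X 1 + C c := aeval_X F 1
  have hf2 : f (X 2) = X 2 + X 1 + C (c * c) := aeval_X F 2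
  have hf3 : f (X 3) = X 3 := aeval_X F 3
  have hg0 : g (X 0) = X 0 := aeval_X G' 0
  have hg1 : g (X 1) = X 1 - C c := aeval_X G' 1
  have hg2 : g (X 2) = X 2 - X 1 + C (c * c) := aeval_X G' 2
  have hg3 : g (X 3) = X 3 := aeval_X G' 3
  have hfC : ∀ a : k, f (C a) = C a := fun a => f.commutes a
  have hgC : ∀ a : k, g (C a) = C a := fun a => g.commutes a
  have hcc : (C (c * c) : MvPolynomial (Fin 4) k) + C (c * c) - C c = 0 := by
    rw [← C_add, ← C_sub, show c * c + c * c - c = c * (2 * c) - c by ring, hc, mul_one, sub_self, C_0]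
  have hfg : f.comp g = AlgHom.id k _ := by
    refine algHom_ext fun l => ?_
    fin_cases l
    · change f (g (X 0)) = X 0; rw [hg0, hf0]
    · change f (g (X 1)) = X 1; rw [hg1, map_sub, hf1, hfC]; ring
    · change f (g (X 2)) = X 2
      rw [hg2, map_add, map_sub, hf2, hf1, hfC]
      linear_combination hcc
    · change f (g (X 3)) = X 3; rw [hg3, hf3]
  have hgf : g.comp f = AlgHom.id k _ := by
    refine algHom_ext fun l => ?_
    fin_cases l
    · change g (f (X 0)) = X 0; rw [hf0, hg0]
    · change g (f (X 1)) = X 1; rw [hf1, map_add, hg1, hgC]; ring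
    · change g (f (X 2)) = X 2
      rw [hf2, map_add, map_add, hg2, hg1, hgC]
      linear_combination hcc
    · change g (f (X 3)) = X 3; rw [hf3, hg3]
  exact ⟨AlgEquiv.ofAlgHom f g hfg hgf, hf0, hf1, hf2, hf3, hg0, hg1, hg2, hg3⟩

end Summit.ResolutionOfSingularities.ResolutionOfSingularities.Theorems.WildQuotientResolution.S1.FreeModel

namespace Summit.ResolutionOfSingularities.ResolutionOfSingularities.Theorems.WildQuotientResolution.S1.GameFrame.GModel

variable {p : ℕ} {X' X₁ : Scheme.{0}} {q : X' ⟶ X₁} {G : Type} [Group G] {ρ : G →* Aut X'} {g₀ : G}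

/-- ★★★ **R4b: `KillsIn 2` FOR THE INITIAL MODEL OF THE PARABOLA TAIL** `x₃ ↦ x₃ + (x₂ − x₁²)` (`x₁ ↦ x₁ + x₀`, `x₂ ↦ x₂ + x₀`): the first NON-ORIGIN centre —
✓`tparab_killsIn_two` in the coordinates `(x₀, y = x₁ − ½, v = x₂ − x₁ + ¼, x₃)` centred at the far tangency point `Q`.
[OURS · L1 W4.5c · R-F15n R4b; NOT a statement of the manuscript] -/
theorem parabola_killsIn_two [Finite G] (hp : p.Prime) (hG : ∀ g : G, g ∈ Subgroup.zpowers g₀) (hg₀ : g₀ ^ p = 1)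
    (hq : ∀ g : G, (ρ g).hom ≫ q = q) [IsIntegral X'] [IsLocallyNoetherian X'] [X'.IsSeparated] [IsAffine X']
    (hreg : Scheme.IsRegular X') {k' : Type} [Field k'] (φ : X₁ ⟶ Spec (.of k')) [IsSeparated φ] [LocallyOfFiniteType φ] [IsFinite q]
    {k : Type} [Field k] [CharP k p] (hp2 : p ≠ 2) (σ : MvPolynomial (Fin 4) k ≃+* MvPolynomial (Fin 4) k) (hC : ∀ a : k, σ (C a) = C a)
    (h0 : σ (X 0) = X 0) (h1 : σ (X 1) = X 1 + X 0) (h2 : σ (X 2) = X 2 + X 0) (h3 : σ (X 3) = X 3 + (X 2 - X 1 ^ 2))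
    (e : Γ(X', ⊤) ≃+* MvPolynomial (Fin 4) k)
    (hστ : ∀ t : Γ(X', ⊤), e ((ρ g₀⁻¹).hom.appLE ⊤ ⊤ (by rw [Scheme.Hom.preimage_top]) t) = σ (e t))
    (h₀ : NodeAtlas p (⟨ρ, hq⟩ : ActionOver q G) g₀) :
    KillsIn 2 (GModel.initial (p := p) (g₀ := g₀) hq h₀) := by
  classical
  haveI : NeZero p := ⟨hp.ne_zero⟩
  have hk2 : (2 : k) ≠ 0 := by
    intro h
    have h' : ((2 : ℕ) : k) = 0 := by exact_mod_cast h
    rw [CharP.cast_eq_zero_iff k p] at h'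
    exact hp2 ((Nat.prime_dvd_prime_iff_eq hp Nat.prime_two).mp h')
  have hc : (2 : k) * 2⁻¹ = 1 := mul_inv_cancel₀ hk2
  -- the affine recoordination (old coordinates in terms of the new ones)
  obtain ⟨γ, hγ0, hγ1, hγ2, hγ3, hγs0, hγs1, hγs2, hγs3⟩ := FreeModel.exists_affineRecoord_parabola k (2⁻¹ : k) hc
  let σ' : MvPolynomial (Fin 4) k ≃+* MvPolynomial (Fin 4) k := (γ.symm.toRingEquiv.trans σ).trans γ.toRingEquiv
  have hσ' : ∀ x, σ' x = γ (σ (γ.symm x)) := fun _ => rfl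
  have hγC : ∀ a : k, γ (C a) = C a := fun a => γ.commutes a
  have hγsC : ∀ a : k, γ.symm (C a) = C a := fun a => γ.symm.commutes a
  have hC' : ∀ a : k, σ' (C a) = C a := fun a => by rw [hσ', hγsC, hC, hγC]
  have h0' : σ' (X 0) = X 0 := by rw [hσ', hγs0, h0, hγ0]
  have h1' : σ' (X 1) = X 1 + X 0 := by rw [hσ', hγs1, map_sub, h1, hC, map_sub, map_add, hγ1, hγ0, hγC]; ring
  have hcc : (C ((2⁻¹ : k) * 2⁻¹) : MvPolynomial (Fin 4) k) + C ((2⁻¹ : k) * 2⁻¹) - C (2⁻¹ : k) = 0 := by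
    rw [← C_add, ← C_sub, show (2⁻¹ : k) * 2⁻¹ + 2⁻¹ * 2⁻¹ - 2⁻¹ = 2⁻¹ * (2 * 2⁻¹) - 2⁻¹ by ring, hc, mul_one, sub_self, C_0]
  have e2 : (2 : MvPolynomial (Fin 4) k) * C (2⁻¹ : k) = 1 := by
    rw [show (2 : MvPolynomial (Fin 4) k) = C (2 : k) from (map_ofNat C 2).symm, ← C_mul, hc, C_1]
  have h2' : σ' (X 2) = X 2 := by
    rw [hσ', hγs2, map_add, map_sub, h2, h1, hC, map_add, map_sub, map_add, map_add, hγ2, hγ1, hγ0, hγC]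
    linear_combination hcc
  have h3' : σ' (X 3) = X 3 + (X 2 - X 1 ^ 2) := by
    rw [hσ', hγs3, h3, map_add, map_sub, map_pow, hγ3, hγ2, hγ1]
    have e1 : (C ((2⁻¹ : k) * 2⁻¹) : MvPolynomial (Fin 4) k) = C (2⁻¹ : k) * C (2⁻¹ : k) := C_mul
    rw [e1]
    linear_combination (-(X 1 : MvPolynomial (Fin 4) k)) * e2
  let e' : Γ(X', ⊤) ≃+* MvPolynomial (Fin 4) k := e.trans γ.toRingEquiv
  have hστ' : ∀ t : Γ(X', ⊤), e' ((ρ g₀⁻¹).hom.appLE ⊤ ⊤ (by rw [Scheme.Hom.preimage_top]) t) = σ' (e' t) := fun t => by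
    change γ (e _) = γ (σ (γ.symm (γ (e t))))
    rw [hστ, γ.symm_apply_apply]
  exact tparab_killsIn_two hp hG hg₀ hq hreg φ hp2 σ' hC' h0' h1' h2' h3' e' hστ' h₀

/-- ★★★ **R4b: the parabola class inhabits the research stub** (✓`exists_reachLowerF_of_killsIn_datum` on `parabola_killsIn_two`).
[OURS · L1 W4.5c · R-F15n R4b; NOT a statement of the manuscript] -/
theorem exists_reachLowerF_initial_of_parabola [Finite G] (hp : p.Prime) (hG : ∀ g : G, g ∈ Subgroup.zpowers g₀) (hg₀ : g₀ ^ p = 1)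
    (hq : ∀ g : G, (ρ g).hom ≫ q = q) [IsIntegral X'] [IsLocallyNoetherian X'] [X'.IsSeparated] [IsAffine X']
    (hreg : Scheme.IsRegular X') {k' : Type} [Field k'] (φ : X₁ ⟶ Spec (.of k')) [IsSeparated φ] [LocallyOfFiniteType φ] [IsFinite q]
    {k : Type} [Field k] [CharP k p] (hp2 : p ≠ 2) (σ : MvPolynomial (Fin 4) k ≃+* MvPolynomial (Fin 4) k) (hC : ∀ a : k, σ (C a) = C a)
    (h0 : σ (X 0) = X 0) (h1 : σ (X 1) = X 1 + X 0) (h2 : σ (X 2) = X 2 + X 0) (h3 : σ (X 3) = X 3 + (X 2 - X 1 ^ 2))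
    (e : Γ(X', ⊤) ≃+* MvPolynomial (Fin 4) k)
    (hστ : ∀ t : Γ(X', ⊤), e ((ρ g₀⁻¹).hom.appLE ⊤ ⊤ (by rw [Scheme.Hom.preimage_top]) t) = σ (e t))
    (h₀ : NodeAtlas p (⟨ρ, hq⟩ : ActionOver q G) g₀) (𝔄₀ : NodeAtlasData p (GModel.initial hq h₀).act g₀) :
    ∃ P : ∀ M : GModel p q G ρ g₀, NodeAtlasData p M.act g₀ → Prop,
      P (GModel.initial hq h₀) 𝔄₀ ∧ ∀ (M : GModel p q G ρ g₀) (𝔄 : NodeAtlasData p M.act g₀), P M 𝔄 → ¬ M.Terminal →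
        ∃ n : ℕ, TreeF P (fun N 𝔅 => LexLTF N 𝔅 M 𝔄) n M 𝔄 :=
  exists_reachLowerF_of_killsIn_datum hp hG φ (GModel.initial hq h₀) 𝔄₀ (parabola_killsIn_two hp hG hg₀ hq hreg φ hp2 σ hC h0 h1 h2 h3 e hστ h₀)

end Summit.ResolutionOfSingularities.ResolutionOfSingularities.Theorems.WildQuotientResolution.S1.GameFrame.GModel

end
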